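import Mathlib
import Summits.KontsevichZagierPeriods.Zeta5Search.DoubleDropBonusProof
import Summits.KontsevichZagierPeriods.Zeta5Search.CasoratianClassBoundProof
import Summits.KontsevichZagierPeriods.Zeta5Search.ClassTypeGuards
import HarnessLib

/-!
# ζ(5) search — the DOUBLE DROP AT ANY DEPTH: `v_p(Cas_j(b)) ≥ 5 − 2N` without `p ≤ d` (DENOM-LAW D1, prover-d1 gen 22)

Cell `pub-zeta5` (HONEST FRAMING: systematic search; no irrationality claim unless certified), TRACK «DENOM-LAW» D1 prover seat
(denom-prover-d1 gen 22, `HOME/denom-law/prover-d1/ATTEMPT-22.md` §6).  gen-2 g9's DOUBLE-DROP BONUS (`DoubleDropBonus`, a theorem by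
`doubleDropBonus_holds`) is stated for `p ≤ d(b)`, where both `Ω`-brackets of the Casoratian split vanish and the bound reads `casLB + 2`.
The SAME hypotheses (regimes H0/T, `N ≥ 3` even, every class below `−N` a tame single, every class at `−N` a tame single or centre-free
palindromic) give, at ANY depth, `v_p(Cas_j(b)) ≥ 5 − 2N`: the four norms of the proof (`‖𝒦(b′)‖ ≤ p^{N−4}`, `‖V(b′)‖ ≤ p^{N−1}` for
`b′ ∈ {b, b + e_j}`, `padicNorm_kRes_le_dd` / `padicNorm_coeffV_le_dd` through `ddHyp_self` / `ddHyp_shift`) bound the `𝒦`-bracket by `p^{2N−5}`,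
and the `Ω`-bracket `Ω(b⁺)V(b) − Ω(b)V(b⁺)`, which no longer vanishes, is bounded by `p^{N−1} ≤ p^{2N−5}` (`N ≥ 4`) since the moments are
`p`-integral (`padicNorm_omegaRes_le_one`).  At `p ≤ d` this is the old bonus (`casLB = 3 − 2N` at a deep multipole class); at `d < p` it is
TWO above THEOREM LB's `VB + min(3 + E, 0) = −N − 1`... i.e. `casLB + 2` with the `d < p` row as well.  Cover form (`doubleDropAnyDepth_of_cover`,
the hypotheses read off gen 10's `checkB`) and the B-law-with-LB-fallback at any depth (`cover_B0_j`, fallback `checkLBx` with `B′ ≤ 0` so that no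
`p ≤ d` is needed there either: `casLB_ge_of_cover_x_le0`).  Consumed by the `N_p = 7, 6` profiles 7c, 6a at `⌊d/p⌋ = 0` (gen 22).  `p`-adic
valuations of the cell's own rationals; nothing about ζ(5); no γ; records in print UNMOVED.
-/

open Finset

namespace Summit.KontsevichZagierPeriods.Zeta5Search.DenomLaw

open Summit.KontsevichZagierPeriods.Zeta5Search.ClusterValuation
open Summit.KontsevichZagierPeriods.Zeta5Search.WedgeDictionary (coeffV dOf)
open Summit.KontsevichZagierPeriods.Zeta5Search.CasoratianValuation (InPolytope shift casoratian)
open Summit.KontsevichZagierPeriods.Zeta5Search.BigPrime (shift_zero)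
open Summit.KontsevichZagierPeriods.Zeta5Search.PadicSeries
open Summit.KontsevichZagierPeriods.Zeta5Search.ClassTypeCover

/-- **The double drop at any depth**: under the hypotheses of `DoubleDropBonus` WITHOUT `p ≤ d(b)`, `v_p(Cas_j(b)) ≥ 5 − 2N`. -/
theorem doubleDrop_anyDepth (b : ℕ → ℤ) (p j N : ℕ) (hb : InPolytope b) (hb' : InPolytope (shift b j)) (hj1 : 1 ≤ j)
    (hprime : p.Prime) (hp5 : 5 ≤ p) (hpb : (p : ℤ) ≤ b 0) (hwin : (b 0 + 2 : ℤ) < (p : ℤ) ^ 2) (hN : 3 ≤ N) (hNe : Even N)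
    (hT : ∀ x, x < p → classExp b p x < -(N : ℤ) → classPoleCount b p x = 1 ∧ tameSingle b p x = true)
    (hD : ∀ x ∈ deepClasses b p N, (classPoleCount b p x = 1 ∧ tameSingle b p x = true) ∨
      (¬ CentreIn b p x ∧ (∀ s ∈ classSet b p x, netExp b s = netExp b ((b 0).toNat - ((b 0).toNat - x) % p - (s - x)))))
    (hcas : casoratian b j ≠ 0) : (5 - 2 * (N : ℤ)) ≤ padicValRat p (casoratian b j) := by
  haveI : Fact p.Prime := ⟨hprime⟩
  have hp0 : 0 < p := hprime.pos
  have hp1 : (1 : ℚ) ≤ p := one_le_p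
  have h0 : 0 ≤ b 0 := hb.1.1
  have hpn : p ≤ (b 0).toNat := by
    have : (((b 0).toNat : ℕ) : ℤ) = b 0 := Int.toNat_of_nonneg h0
    omega
  have hwin' : (shift b j 0 + 2 : ℤ) < (p : ℤ) ^ 2 := by rwa [shift_zero b hj1]
  have hpn' : p ≤ (shift b j 0).toNat := by rwa [shift_zero b hj1]
  have hN4 : 4 ≤ N := by obtain ⟨k, hk⟩ := hNe; omega
  have hHb := ddHyp_self b hT hD
  have hHb' := ddHyp_shift b hb hj1 hp0 hT hD
  have hK := padicNorm_kRes_le_dd b hb hp5 hwin hN hNe hHb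
  have hK' := padicNorm_kRes_le_dd (shift b j) hb' hp5 hwin' hN hNe hHb'
  have hV := padicNorm_coeffV_le_dd b hb hp5 hpn hwin hN hNe hHb
  have hV' := padicNorm_coeffV_le_dd (shift b j) hb' hp5 hpn' hwin' hN hNe hHb'
  have hΩ : padicNorm p (omegaRes b p) ≤ (p : ℚ) ^ (0 : ℤ) := by
    simpa using padicNorm_omegaRes_le_one b hb (by omega)
  have hΩ' : padicNorm p (omegaRes (shift b j) p) ≤ (p : ℚ) ^ (0 : ℤ) := by
    simpa using padicNorm_omegaRes_le_one (shift b j) hb' (by omega)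
  apply val_ge_of_padicNorm_le hcas
  rw [casoratian_split b j p]
  refine (padicNorm.sub (p := p)).trans (max_le ?_ ?_)
  · exact ((padicNorm.sub (p := p)).trans (max_le (padicNorm_mul_le hΩ' hV) (padicNorm_mul_le hΩ hV'))).trans
      (zpow_le_zpow_right₀ hp1 (by omega))
  · exact ((padicNorm.sub (p := p)).trans (max_le (padicNorm_mul_le hK' hV) (padicNorm_mul_le hK hV'))).trans
      (zpow_le_zpow_right₀ hp1 (by omega))

/-- **The double drop at any depth from a cover**: the hypotheses read off gen 10's `checkB` on the cover's type list, plus one multipole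
class of exponent exactly `−N` realised. -/
theorem doubleDropAnyDepth_of_cover {p : ℕ} {b : ℕ → ℤ} {j : ℕ} (hb : InPolytope b) (hj1 : 1 ≤ j)
    (hb' : InPolytope (shift b j)) (hpr : p.Prime) (hp5 : 5 ≤ p) (hpb : (p : ℤ) ≤ b 0)
    (hwin : (b 0 + 2 : ℤ) < (p : ℤ) ^ 2) {TY : List (List ℤ × Bool)} (hcov : Cover b p TY) {N : ℕ} (hN : 3 ≤ N)
    (hNe : Even N) (hchk : checkB (decide (¬ (2 : ℤ) ∣ b 0)) TY N = true) (hcas : casoratian b j ≠ 0) :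
    (5 - 2 * (N : ℤ)) ≤ padicValRat p (casoratian b j) := by
  haveI : Fact p.Prime := ⟨hpr⟩
  rw [checkB, List.all_eq_true] at hchk
  refine doubleDrop_anyDepth b p j N hb hb' hj1 hpr hp5 hpb hwin hN hNe ?_ ?_ hcas
  · intro x hx hE
    obtain ⟨tc, htc, ht⟩ := hcov x hx
    have hc0 := hchk tc htc
    simp only [Bool.or_eq_true, Bool.not_eq_true', decide_eq_false_iff_not, Bool.and_eq_true,
      decide_eq_true_eq] at hc0
    have hc := hc0.1
    rw [ht.classExp_eq] at hE
    rw [ht.classPoleCount_eq, ht.tameSingle_eq]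
    rcases hc with h | h
    · exact absurd hE h
    · exact h
  · intro x hxd
    obtain ⟨hx, hE⟩ := (mem_deepClasses_iff b p N x).1 hxd
    obtain ⟨tc, htc, ht⟩ := hcov x hx
    have hc0 := hchk tc htc
    simp only [Bool.or_eq_true, Bool.not_eq_true', decide_eq_false_iff_not, Bool.and_eq_true,
      decide_eq_true_eq] at hc0
    have hc := hc0.2
    rw [ht.classExp_eq] at hE
    rcases hc with h | h | ⟨hc1, hc2⟩
    · exact absurd hE h
    · left; rw [ht.classPoleCount_eq, ht.tameSingle_eq]; exact h
    · right
      refine ⟨fun hcen => ?_, ht.pal_classSet hc2⟩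
      have := ht.cen_iff.1 hcen
      rw [this] at hc1
      exact Bool.noConfusion hc1

/-- **THEOREM LB's value from a cover off the `m`-types, `B ≤ 0`, any depth**: `A + B ≤ casLB b p` (or no pole class at all) from
`checkLBx`, with `B ≤ 0` in place of `p ≤ d` (the `d < p` row is `0`). -/
theorem casLB_ge_of_cover_x_le0 {p : ℕ} [Fact p.Prime] {b : ℕ → ℤ} {TY : List (List ℤ × Bool)} (hcov : Cover b p TY) {m A B : ℤ}
    (hchk : checkLBx (decide (¬ (2 : ℤ) ∣ b 0)) TY m A B = true) (hB0 : B ≤ 0)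
    (hnreal : ¬ ∃ x, x < p ∧ 2 ≤ classPoleCount b p x ∧ classExp b p x = m) :
    casLB b p = 0 ∨ A + B ≤ casLB b p := by
  rw [checkLBx, List.all_eq_true] at hchk
  have hA : ∀ x, x < p → 1 ≤ classPoleCount b p x → A ≤ classNu b p x := by
    intro x hx h1
    obtain ⟨tc, htc, ht⟩ := hcov x hx
    have hc := hchk tc htc
    simp only [Bool.and_eq_true, Bool.or_eq_true, decide_eq_true_eq] at hc
    rw [ht.classPoleCount_eq] at h1
    rw [ht.classNu_eq]
    rcases hc with ⟨h2, hE⟩ | ⟨h0 | hA, -⟩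
    · exact absurd ⟨x, hx, by rw [ht.classPoleCount_eq]; exact h2, by rw [ht.classExp_eq]; exact hE⟩ hnreal
    · omega
    · exact hA
  have hB : ∀ x, x < p → 2 ≤ classPoleCount b p x → B ≤ 3 + classExp b p x := by
    intro x hx h2
    obtain ⟨tc, htc, ht⟩ := hcov x hx
    have hc := hchk tc htc
    simp only [Bool.and_eq_true, Bool.or_eq_true, decide_eq_true_eq] at hc
    rw [ht.classPoleCount_eq] at h2
    rw [ht.classExp_eq]
    rcases hc with ⟨h2', hE⟩ | ⟨-, h0 | hB⟩
    · exact absurd ⟨x, hx, by rw [ht.classPoleCount_eq]; exact h2', by rw [ht.classExp_eq]; exact hE⟩ hnreal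
    · omega
    · exact hB
  rcases casLB_ge_or_noPole b p A B hA (by omega) hB (fun _ => hB0) with ⟨h0, -⟩ | h
  · exact Or.inl h0
  · exact Or.inr h

/-- **The B-law at any depth, any direction `j`, from a cover**: with a multipole class at `−N` realised the double drop gives `5 − 2N`;
otherwise THEOREM LB off the `−N`-types (`checkLBx` at `(A′, B′)`, `B′ ≤ 0`) gives `A′ + B′`; so `c ≤ v_p(Cas_j(b))` for any
`c ≤ 5 − 2N`, `c ≤ A′ + B′`, `c ≤ 0`. -/
theorem cover_B0_j {p : ℕ} {b : ℕ → ℤ} {j : ℕ} (hb : InPolytope b) (hj1 : 1 ≤ j) (hj7 : j ≤ 7) (hb' : InPolytope (shift b j))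
    (hpr : p.Prime) (hp5 : 5 ≤ p) (hpb : (p : ℤ) ≤ b 0) (hwin : (b 0 + 2 : ℤ) < (p : ℤ) ^ 2)
    {TY : List (List ℤ × Bool)} (hcov : Cover b p TY) {N : ℕ} (hN : 3 ≤ N) (hNe : Even N) {A' B' c : ℤ}
    (hchkB : checkB (decide (¬ (2 : ℤ) ∣ b 0)) TY N = true)
    (hLBx : checkLBx (decide (¬ (2 : ℤ) ∣ b 0)) TY (-(N : ℤ)) A' B' = true) (hB0 : B' ≤ 0)
    (hc : c ≤ 5 - 2 * (N : ℤ)) (hc' : c ≤ A' + B') (hc0 : c ≤ 0)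
    (hne : casoratian b j ≠ 0) : c ≤ padicValRat p (casoratian b j) := by
  haveI : Fact p.Prime := ⟨hpr⟩
  have hv := casoratianClassBound_holds b j p hb hj1 hj7 hb' hpr hp5 hwin hne
  by_cases hreal : ∃ x, x < p ∧ 2 ≤ classPoleCount b p x ∧ classExp b p x = -(N : ℤ)
  · have hB := doubleDropAnyDepth_of_cover hb hj1 hb' hpr hp5 hpb hwin hcov hN hNe hchkB hne
    have : (c : ℚ) ≤ (5 - 2 * (N : ℤ) : ℤ) := by exact_mod_cast hc
    push_cast at this
    linarith
  · rcases casLB_ge_of_cover_x_le0 hcov hLBx hB0 hreal with h0 | h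
    · rw [h0] at hv; exact le_trans (by exact_mod_cast hc0) hv
    · have : (c : ℚ) ≤ (casLB b p : ℚ) := by exact_mod_cast (hc'.trans h)
      linarith

end Summit.KontsevichZagierPeriods.Zeta5Search.DenomLaw
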